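import Literature.MathematicalPhysics.QuantumLattice.PairingChannelIdentities
import Literature.MathematicalPhysics.QuantumLattice.FermionOperatorsProofs
import Literature.MathematicalPhysics.QuantumLattice.PairCorrelationsProofs
import HarnessLib

/-!
# Discharge of Zhang's on-site / extended-`s` commutator identity (`zhang_pairing_commutator`)

Trunk T-QLATTICE, family `hubbard`. Sibling PROOF file of
`Literature/MathematicalPhysics/QuantumLattice/PairingChannelIdentities.lean`: it proves the named
fact `zhang_pairing_commutator` stated there (S. Zhang, PRB 42 (1990) 1012; restated open-access as
eq. (4) of You–Gu–Tian–Lin, PRB 79 (2009) 014508 = arXiv:0807.1493, one-orbital case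
`t_⊥ = t`, `t_∥ = t₃ = t₄ = U_cd = 0`, at `μ = 0`): on the fermionic torus `(ℤ/Lℤ)²`, `L ≥ 3`,
`H P_s - P_s H = 2t P_{s*} - U P_s` for `H = hubbardTorus 2 L t U`, `P_s = pairField sWave L`,
`P_{s*} = pairField extendedSWave L`. No definition and no new named fact is introduced.

## The printed argument and its formalisation

You et al. obtain (4) "by calculating the commutation relation with the Hamiltonian" of the
on-site pair `Δ_r = c_{r↑} c_{r↓}`: the kinetic term `-t Σ_{⟨ij⟩σ} (c†_{iσ} c_{jσ} + h.c.)` turns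
`Δ_r` into the nearest-neighbour singlet bonds `Σ_{δ = ±x̂, ±ŷ} (c_{r↑} c_{r+δ,↓} - c_{r↓} c_{r+δ,↑})`
(summed over `r` this is `N Δ_{s*}`), and the Hubbard interaction counts the doubly occupied site
removed by `Δ_r`, `[U Σ_i n_{i↑} n_{i↓}, Δ_r] = -U Δ_r`. The file mirrors this (all finite CAR
bookkeeping on the Jordan–Wigner matrices of the tree):

* `bilinear_pairAnnihilation_commutator` — `[c†_a c_b, c_p c_q] = δ_{ap} c_q c_b - δ_{aq} c_p c_b`
  (adjoint of the tree's `hop_pair_commutator`), whence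
  `hopping_commutator_pairAnnihilation` — `[Σ_σ c†_{xσ} c_{yσ}, c_{z↑} c_{z↓}] = δ_{xz} (c_{z↓} c_{y↑} - c_{z↑} c_{y↓})`
  and `interaction_commutator_pairAnnihilation` — `[Σ_x n_{x↑} n_{x↓}, c_{z↑} c_{z↓}] = -c_{z↑} c_{z↓}`
  (adjoint of the tree's `pairNumber_commutator_pairCreation`);
* torus bookkeeping for `L ≥ 3` (`torusGraph_adj_iff_unitSteps`, `sum_ite_adj_eq_sum_unitSteps`,
  `hoppingSum_fermionTorus_eq`): the neighbours of a site `x` of `(ℤ/Lℤ)²` are the four DISTINCT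
  sites `x + e`, `e ∈ unitSteps = {±e₁, ±e₂}`, so the hopping term of `hubbardTorus 2 L t U` is
  `-t Σ_x Σ_{e ∈ unitSteps} Σ_σ c†_{xσ} c_{x+e,σ}` (for `L ≤ 2` the steps coincide in pairs and the
  identity fails by a factor — the reason for the guard `2 < L` in the fact);
* normal forms `P_s = √2 Σ_x c_{x↑} c_{x↓}` (`pairField_sWave_eq`) and
  `P_{s*} = (1/√2) Σ_x Σ_{e ∈ unitSteps} (c_{x↑} c_{x+e,↓} - c_{x↓} c_{x+e,↑})` (`pairField_extendedSWave_eq`);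
* `hubbardTorus_commutator_onsitePairSum` —
  `[H(t,U), Σ_y c_{y↑} c_{y↓}] = t Σ_x Σ_e (c_{x↑} c_{x+e,↓} - c_{x↓} c_{x+e,↑}) - U Σ_y c_{y↑} c_{y↓}`,
  i.e. You et al. (4) times `N`; multiplying by `√2` gives `zhang_pairing_commutator_holds`.

The helper lemmas are adapted (generalised from `t = 1` to arbitrary real `t`) from the
problem-side files `Summits/HubbardSuperconductivity/HubbardSuperconductivity/Theorems/
EnslavedA1gIdentity.lean` and `EnslavedA1gTorusNormalForms.lean`, which Literature cannot import;
they live in the sub-namespace `Literature.MathematicalPhysics.QuantumLattice.ZhangPairing`.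

## Sources

* W.-L. You, S.-J. Gu, G.-S. Tian, H.-Q. Lin, *Constraints on the possible pairing symmetry of
  iron arsenide superconductors in a two-orbital model*, Phys. Rev. B 79 (2009) 014508,
  arXiv:0807.1493 [YouEtAl2009]: Hamiltonian (1)–(3) (p. 1), pair operators `Δ_r`, `Δ_{r+δ}`,
  `Δ_s = Σ_r Δ_r/N`, `Δ_{s*} = Σ_r (Δ_{r-x̂} + Δ_{r+x̂} + Δ_{r-ŷ} + Δ_{r+ŷ})/N` and eq. (4) (p. 2),
  ref. [36] = Zhang (1990).
* S. Zhang, *Constraints on s-wave pairing in the Hubbard model*, Phys. Rev. B 42 (1990) 1012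
  [ZhangPRB1990] (paywalled, cite-only; source of record of the identity).
* F. H. L. Essler et al., *The One-Dimensional Hubbard Model* (CUP 2005), §2.1–§2.2 (CAR,
  commutators of fermion bilinears) — as in `FermionOperatorsProofs`.
-/

noncomputable section

namespace Literature.MathematicalPhysics.QuantumLattice

namespace ZhangPairing

open Matrix Finset Literature.Probability.LatticeModels
open scoped ComplexOrder

/-! ### CAR consequences: commutators of fermion bilinears with a pair annihilator -/

section CAR

variable {ι : Type*} [LinearOrder ι] [Fintype ι]

/-- `c_i c_j = -c_j c_i` (pure CAR, from `annihilation_anticommute_holds`).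
Essler et al. (2005) §2.1, eq. (2.2a). [folklore] -/
private theorem annihilation_mul_annihilation_eq_neg (i j : ι) :
    annihilation i * annihilation j = -(annihilation j * annihilation i) :=
  eq_neg_of_add_eq_zero_left (annihilation_anticommute_holds i j)

/-- `[c†_a c_b, c_p c_q] = δ_{ap} c_q c_b - δ_{aq} c_p c_b` (adjoint of `hop_pair_commutator`).
Essler et al. (2005) §2.2, eq. (2.72) (commutators of fermion bilinears). [folklore] -/
-- adapted from Summits/HubbardSuperconductivity/HubbardSuperconductivity/Theorems/EnslavedA1gIdentity.lean
private theorem bilinear_pairAnnihilation_commutator (a b p q : ι) :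
    creation a * annihilation b * (annihilation p * annihilation q) -
        annihilation p * annihilation q * (creation a * annihilation b) =
      (if a = p then annihilation q * annihilation b else 0) -
        (if a = q then annihilation p * annihilation b else 0) := by
  have h := congrArg Matrix.conjTranspose (hop_pair_commutator b a q p)
  simp only [conjTranspose_sub, conjTranspose_mul, creation_conjTranspose,
    annihilation_conjTranspose, apply_ite Matrix.conjTranspose, conjTranspose_zero] at h
  calc creation a * annihilation b * (annihilation p * annihilation q) -
        annihilation p * annihilation q * (creation a * annihilation b)
      = -(annihilation p * annihilation q * (creation a * annihilation b) -
          creation a * annihilation b * (annihilation p * annihilation q)) := by abel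
    _ = -((if a = q then annihilation p * annihilation b else 0) -
          (if a = p then annihilation q * annihilation b else 0)) := by rw [h]
    _ = _ := by abel

end CAR

section HubbardCommutators

variable {Λ : Type*} [LinearOrder Λ] [Fintype Λ]

/-- `[n_{x↑} n_{x↓}, c_{z↑} c_{z↓}] = -δ_{xz} c_{z↑} c_{z↓}` (adjoint of
`pairNumber_commutator_pairCreation`; the pair annihilator lowers the double occupancy of its
site by one). Essler et al. (2005) §2.1, eqs. (2.8)–(2.11). [folklore] -/
-- adapted from Summits/HubbardSuperconductivity/HubbardSuperconductivity/Theorems/EnslavedA1gIdentity.lean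
private theorem pairNumber_commutator_pairAnnihilation (x z : Λ) :
    numberOp x 0 * numberOp x 1 * (annihilation (orb z 0) * annihilation (orb z 1)) -
        annihilation (orb z 0) * annihilation (orb z 1) * (numberOp x 0 * numberOp x 1) =
      if x = z then -(annihilation (orb z 0) * annihilation (orb z 1)) else 0 := by
  have h := congrArg Matrix.conjTranspose (pairNumber_commutator_pairCreation x z)
  have hN : (numberOp x 0 * numberOp x 1)ᴴ = numberOp x 0 * numberOp x 1 := by
    rw [conjTranspose_mul]
    simp only [numberOp, conjTranspose_mul, creation_conjTranspose, annihilation_conjTranspose]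
    exact (numberAt_commute (orb x 1) (orb x 0)).eq
  simp only [conjTranspose_sub, conjTranspose_mul, creation_conjTranspose, hN,
    apply_ite Matrix.conjTranspose, conjTranspose_zero] at h
  -- `h : c_{z↓} c_{z↑} N - N (c_{z↓} c_{z↑}) = if x = z then c_{z↓} c_{z↑} else 0`
  rw [annihilation_mul_annihilation_eq_neg (orb z 1) (orb z 0)] at h
  split_ifs at h with hxz
  · rw [if_pos hxz]
    calc numberOp x 0 * numberOp x 1 * (annihilation (orb z 0) * annihilation (orb z 1)) -
          annihilation (orb z 0) * annihilation (orb z 1) * (numberOp x 0 * numberOp x 1)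
        = -(annihilation (orb z 0) * annihilation (orb z 1)) * (numberOp x 0 * numberOp x 1) -
            numberOp x 0 * numberOp x 1 * -(annihilation (orb z 0) * annihilation (orb z 1)) := by
          noncomm_ring
      _ = _ := h
  · rw [if_neg hxz]
    calc numberOp x 0 * numberOp x 1 * (annihilation (orb z 0) * annihilation (orb z 1)) -
          annihilation (orb z 0) * annihilation (orb z 1) * (numberOp x 0 * numberOp x 1)
        = -(annihilation (orb z 0) * annihilation (orb z 1)) * (numberOp x 0 * numberOp x 1) -
            numberOp x 0 * numberOp x 1 * -(annihilation (orb z 0) * annihilation (orb z 1)) := by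
          noncomm_ring
      _ = 0 := h

/-- **The interaction term counts the removed double occupancy**:
`[Σ_x n_{x↑} n_{x↓}, c_{z↑} c_{z↓}] = -c_{z↑} c_{z↓}` (the `U`-part of You et al. (4):
`[U Σ_i n_{i↑} n_{i↓}, Δ_r] = -U Δ_r`). You–Gu–Tian–Lin (2009), eq. (4); Yang, PRL 63 (1989) 2144,
eq. (6) (adjoint form). [cite: YouEtAl2009, eq. (4)] -/
private theorem interaction_commutator_pairAnnihilation (z : Λ) :
    (∑ x, numberOp x 0 * numberOp x 1) * (annihilation (orb z 0) * annihilation (orb z 1)) -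
        annihilation (orb z 0) * annihilation (orb z 1) * ∑ x, numberOp x 0 * numberOp x 1 =
      -(annihilation (orb z 0) * annihilation (orb z 1)) := by
  rw [Finset.sum_mul, Finset.mul_sum, ← Finset.sum_sub_distrib]
  simp only [pairNumber_commutator_pairAnnihilation, Finset.sum_ite_eq', Finset.mem_univ, if_true]

/-- **The kinetic term turns an on-site pair into a singlet bond**:
`[Σ_σ c†_{xσ} c_{yσ}, c_{z↑} c_{z↓}] = δ_{xz} (c_{z↓} c_{y↑} - c_{z↑} c_{y↓})` (the `t`-part of
You et al. (4), one ordered bond at a time). You–Gu–Tian–Lin (2009), eq. (4). [cite: YouEtAl2009, eq. (4)] -/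
private theorem hopping_commutator_pairAnnihilation (x y z : Λ) :
    (∑ σ : Fin 2, creation (orb x σ) * annihilation (orb y σ)) *
          (annihilation (orb z 0) * annihilation (orb z 1)) -
        annihilation (orb z 0) * annihilation (orb z 1) *
          ∑ σ : Fin 2, creation (orb x σ) * annihilation (orb y σ) =
      if x = z then
        annihilation (orb z 1) * annihilation (orb y 0) -
          annihilation (orb z 0) * annihilation (orb y 1)
      else 0 := by
  rw [Finset.sum_mul, Finset.mul_sum, ← Finset.sum_sub_distrib, Fin.sum_univ_two,
    bilinear_pairAnnihilation_commutator, bilinear_pairAnnihilation_commutator]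
  simp only [orb_eq_orb_iff, and_true, and_false, if_false, sub_zero, zero_sub,
    Fin.zero_eq_one_iff, OfNat.ofNat_ne_one, one_ne_zero]
  split_ifs <;> abel

end HubbardCommutators

/-! ### Torus geometry: the four neighbours of a site of `(ℤ/Lℤ)²` for `L ≥ 3` -/

section TorusGeometry

variable {L : ℕ}

/-- `Torus.proj` of a unit coordinate vector is the unit coordinate vector of the torus.
Friedli–Velenik (2017) §3.1. [folklore] -/
-- adapted from Summits/HubbardSuperconductivity/HubbardSuperconductivity/Theorems/EnslavedA1gTorusNormalForms.lean
private theorem torusProj_single_two (L : ℕ) (i : Fin 2) :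
    Torus.proj (d := 2) L (Pi.single i 1) = Pi.single i 1 := by
  funext j
  by_cases h : j = i
  · subst h; simp [Torus.proj]
  · simp [Torus.proj, h]

/-- `Torus.proj L 0 = 0`. Friedli–Velenik (2017) §3.1. [folklore] -/
private theorem torusProj_zero_two (L : ℕ) : Torus.proj (d := 2) L 0 = 0 := by
  funext j; simp [Torus.proj]

/-- `1 ≠ 0` in `ℤ/Lℤ` for `L ≥ 3`. [folklore] -/
private theorem one_ne_zero_zmod (hL : 2 < L) : (1 : ZMod L) ≠ 0 := by
  haveI : Fact (1 < L) := ⟨by omega⟩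
  exact one_ne_zero

/-- `1 ≠ -1` in `ℤ/Lℤ` for `L ≥ 3`. [folklore] -/
private theorem one_ne_neg_one_zmod (hL : 2 < L) : (1 : ZMod L) ≠ -1 := by
  haveI : Fact (2 < L) := ⟨hL⟩
  exact fun h => ZMod.neg_one_ne_one h.symm

/-- For `L ≥ 3`, adjacency on the discrete torus `(ℤ/Lℤ)²` means `z = y + e` for one of the four
unit steps `e ∈ {±e₁, ±e₂}`. Friedli–Velenik (2017) §3.1. [folklore] -/
private theorem torusGraph_adj_iff_unitSteps (hL : 2 < L) (y z : TorusSite 2 L) :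
    (torusGraph 2 L).Adj y z ↔ ∃ e ∈ unitSteps, z = y + Torus.proj L e := by
  rw [torusGraph_adj_iff]
  constructor
  · rintro ⟨-, ⟨i, rfl⟩ | ⟨i, rfl⟩⟩
    · refine ⟨Pi.single i 1, ?_, by rw [torusProj_single_two]⟩
      fin_cases i <;> simp [unitSteps]
    · refine ⟨-Pi.single i 1, ?_, ?_⟩
      · fin_cases i <;> simp [unitSteps]
      · rw [Torus.proj_neg, torusProj_single_two, add_neg_cancel_right]
  · rintro ⟨e, he, rfl⟩
    have h1 := one_ne_zero_zmod hL
    simp only [unitSteps, mem_insert, mem_singleton] at he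
    have hne : Torus.proj (d := 2) L e ≠ 0 := by
      intro h0
      rcases he with rfl | rfl | rfl | rfl
      · exact h1 (by simpa [torusProj_single_two] using congrFun h0 0)
      · exact h1 (by simpa [Torus.proj_neg, torusProj_single_two] using congrFun h0 0)
      · exact h1 (by simpa [torusProj_single_two] using congrFun h0 1)
      · exact h1 (by simpa [Torus.proj_neg, torusProj_single_two] using congrFun h0 1)
    refine ⟨fun h => hne (left_eq_add.mp h), ?_⟩
    rcases he with rfl | rfl | rfl | rfl
    · exact Or.inl ⟨0, by rw [torusProj_single_two]⟩
    · exact Or.inr ⟨0, by rw [Torus.proj_neg, torusProj_single_two, neg_add_cancel_right]⟩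
    · exact Or.inl ⟨1, by rw [torusProj_single_two]⟩
    · exact Or.inr ⟨1, by rw [Torus.proj_neg, torusProj_single_two, neg_add_cancel_right]⟩

/-- For `L ≥ 3` the four unit steps project to four DISTINCT torus vectors (`1 ≠ 0`, `1 ≠ -1`
in `ℤ/Lℤ`). Friedli–Velenik (2017) §3.1. [folklore] -/
private theorem torusProj_injOn_unitSteps (hL : 2 < L) :
    Set.InjOn (Torus.proj (d := 2) L) unitSteps := by
  have h1 := one_ne_zero_zmod hL
  have h2 := one_ne_neg_one_zmod hL
  intro e₁ h₁ e₂ h₂ h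
  have e0 := congrFun h 0
  have e1 := congrFun h 1
  simp only [coe_insert, coe_singleton, unitSteps, Set.mem_insert_iff, Set.mem_singleton_iff] at h₁ h₂
  rcases h₁ with rfl | rfl | rfl | rfl <;> rcases h₂ with rfl | rfl | rfl | rfl <;>
    first
    | rfl
    | (exfalso; simp [Torus.proj] at e0 e1; first
        | exact h1 e0 | exact h1 e0.symm | exact h1 e1 | exact h1 e1.symm
        | exact h2 e0 | exact h2 e0.symm | exact h2 e1 | exact h2 e1.symm)

/-- **Neighbour sums on the torus, `L ≥ 3`.** A sum over the torus sites adjacent to `y` is the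
sum over the four unit steps `e` of the value at `y + e`. Friedli–Velenik (2017) §3.1. [folklore] -/
private theorem sum_ite_adj_eq_sum_unitSteps {M : Type*} [AddCommMonoid M] [NeZero L] (hL : 2 < L)
    (y : TorusSite 2 L) (f : TorusSite 2 L → M) :
    ∑ z, (if (torusGraph 2 L).Adj y z then f z else 0) =
      ∑ e ∈ unitSteps, f (y + Torus.proj L e) := by
  classical
  rw [← Finset.sum_filter]
  have hinj : Set.InjOn (fun e : Site 2 => y + Torus.proj L e) unitSteps :=
    fun e₁ h₁ e₂ h₂ h => torusProj_injOn_unitSteps hL h₁ h₂ (add_left_cancel h)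
  rw [← Finset.sum_image hinj]
  refine Finset.sum_congr ?_ fun _ _ => rfl
  ext z
  simp only [mem_filter, mem_univ, true_and, mem_image, torusGraph_adj_iff_unitSteps hL]
  constructor
  · rintro ⟨e, he, rfl⟩; exact ⟨e, he, rfl⟩
  · rintro ⟨e, he, rfl⟩; exact ⟨e, he, rfl⟩

/-- Neighbour sums on the fermionic torus (`FermionTorus 2 L`, adjacency pulled back from
`torusGraph`), `L ≥ 3`: the sum over the neighbours of `y` is the sum over the four unit steps.
Friedli–Velenik (2017) §3.1. [folklore] -/
private theorem sum_ite_fermionAdj_eq_sum_unitSteps {M : Type*} [AddCommMonoid M] [NeZero L] (hL : 2 < L)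
    (y : FermionTorus 2 L) (F : FermionTorus 2 L → M) :
    ∑ z, (if (fermionTorusGraph 2 L).Adj y z then F z else 0) =
      ∑ e ∈ unitSteps, F (FermionTorus.ofTorusSite (y.toTorusSite + Torus.proj L e)) := by
  rw [← (FermionTorus.equivTorusSite (d := 2) (L := L)).symm.sum_comp]
  simp only [fermionTorusGraph_adj]
  have h : ∀ x : TorusSite 2 L,
      ((FermionTorus.equivTorusSite (d := 2) (L := L)).symm x) = FermionTorus.ofTorusSite x :=
    fun _ => rfl
  simp only [h, FermionTorus.toTorusSite_ofTorusSite]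
  exact sum_ite_adj_eq_sum_unitSteps hL _ _

/-- `0` is not a unit step. [folklore] -/
private theorem zero_notMem_unitSteps : (0 : Site 2) ∉ unitSteps := by
  simp only [unitSteps, mem_insert, mem_singleton]
  decide

end TorusGeometry

/-! ### Normal forms of the pair fields and of the hopping term, indexed by torus sites -/

section NormalForms

variable (L : ℕ) [NeZero L]

omit [NeZero L] in
/-- `(1/√2) · 2 = √2` in `ℂ`. [folklore] -/
private theorem inv_sqrt_two_mul_two : ((1 / Real.sqrt 2 : ℝ) : ℂ) * 2 = ((Real.sqrt 2 : ℝ) : ℂ) := by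
  have h : (1 / Real.sqrt 2 : ℝ) * 2 = Real.sqrt 2 := by
    rw [one_div_mul_eq_div, Real.div_sqrt]
  exact_mod_cast h

omit [NeZero L] in
/-- `(2t) · (1/√2) = √2 · t` in `ℂ` (the normalisation `N Δ_s = P_s/√2`, `N Δ_{s*} = √2 P_{s*}`
of the tree's pair fields against You et al.'s). [folklore] -/
private theorem two_mul_mul_inv_sqrt_two (t : ℝ) :
    ((2 * t : ℝ) : ℂ) * ((1 / Real.sqrt 2 : ℝ) : ℂ) = ((Real.sqrt 2 : ℝ) : ℂ) * (t : ℂ) := by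
  have h : (2 * t : ℝ) * (1 / Real.sqrt 2) = Real.sqrt 2 * t := by
    rw [mul_comm (2 : ℝ) t, mul_assoc, mul_one_div, Real.div_sqrt, mul_comm]
  exact_mod_cast h

/-- **Normal form of the on-site pair field**: `P_s = pairField sWave L = √2 Σ_x c_{x↑} c_{x↓}`
(only the step `e = 0` of `localPair` survives, and `c_{x↓} c_{x↑} = -c_{x↑} c_{x↓}`), i.e.
`P_s = √2 N Δ_s` in the notation of You et al. Scalapino, Phys. Rep. 250 (1995) 329, §2;
You–Gu–Tian–Lin (2009), p. 2 (`Δ_s = Σ_r c_{r↑} c_{r↓}/N`). [folklore] -/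
private theorem pairField_sWave_eq :
    pairField sWave L = ((Real.sqrt 2 : ℝ) : ℂ) •
      ∑ x : TorusSite 2 L, annihilation (orb (FermionTorus.ofTorusSite x) 0) *
        annihilation (orb (FermionTorus.ofTorusSite x) 1) := by
  unfold pairField localPair
  rw [Finset.smul_sum]
  refine Finset.sum_congr rfl fun x _ => ?_
  rw [Finset.sum_eq_single_of_mem (0 : Site 2) (Finset.mem_insert_self _ _)]
  · have h0 : sWave 0 = 1 := if_pos rfl
    simp only [h0, torusProj_zero_two, add_zero]
    rw [annihilation_mul_annihilation_eq_neg (orb (FermionTorus.ofTorusSite x) 1)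
      (orb (FermionTorus.ofTorusSite x) 0), sub_neg_eq_add, ← two_smul ℂ, smul_smul,
      inv_sqrt_two_mul_two]
  · intro e _ hne
    have : sWave e = 0 := if_neg hne
    simp [this]

/-- **The extended-`s` pair field over the unit steps**:
`P_{s*} = (1/√2) Σ_x Σ_{e ∈ unitSteps} (c_{x↑} c_{x+e,↓} - c_{x↓} c_{x+e,↑})` (the `e = 0` term
carries `extendedSWave 0 = 0`), i.e. `P_{s*} = N Δ_{s*}/√2` in the notation of You et al.
Scalapino, Phys. Rep. 250 (1995) 329, §2; You–Gu–Tian–Lin (2009), p. 2. [folklore] -/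
private theorem pairField_extendedSWave_eq :
    pairField extendedSWave L = ((1 / Real.sqrt 2 : ℝ) : ℂ) •
      ∑ x : TorusSite 2 L, ∑ e ∈ unitSteps,
        (annihilation (orb (FermionTorus.ofTorusSite x) 0) *
            annihilation (orb (FermionTorus.ofTorusSite (x + Torus.proj L e)) 1) -
          annihilation (orb (FermionTorus.ofTorusSite x) 1) *
            annihilation (orb (FermionTorus.ofTorusSite (x + Torus.proj L e)) 0)) := by
  unfold pairField localPair
  rw [Finset.smul_sum]
  refine Finset.sum_congr rfl fun x _ => ?_
  rw [Finset.sum_insert zero_notMem_unitSteps, Finset.smul_sum]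
  have h0 : extendedSWave 0 = 0 := if_neg zero_notMem_unitSteps
  simp only [h0, zero_div, Complex.ofReal_zero, zero_smul, zero_add]
  refine Finset.sum_congr rfl fun e he => ?_
  have h1 : extendedSWave e = 1 := if_pos he
  rw [h1]

/-- Sums over the fermionic torus are sums over the statistical-mechanics torus along
`FermionTorus.ofTorusSite`. Friedli–Velenik (2017) §3.1. [folklore] -/
private theorem sum_fermionTorus_eq_sum_torusSite {M : Type*} [AddCommMonoid M]
    (G : FermionTorus 2 L → M) :
    ∑ X : FermionTorus 2 L, G X = ∑ x : TorusSite 2 L, G (FermionTorus.ofTorusSite x) :=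
  ((FermionTorus.equivTorusSite (d := 2) (L := L)).symm.sum_comp G).symm

variable {L}

/-- **The hopping term of `hubbardTorus 2 L t U` in unit-step form** (`L ≥ 3`):
`Σ_{X,Y adjacent} Σ_σ c†_{Xσ} c_{Yσ} = Σ_x Σ_{e ∈ unitSteps} Σ_σ c†_{xσ} c_{x+e,σ}`, the sites
being parametrised by the statistical-mechanics torus through `FermionTorus.ofTorusSite`.
Friedli–Velenik (2017) §3.1; Lieb–Wu, PRL 20 (1968) 1445. [folklore] -/
private theorem hoppingSum_fermionTorus_eq (hL : 2 < L) :
    (∑ X : FermionTorus 2 L, ∑ Y : FermionTorus 2 L, ∑ σ : Fin 2,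
        if (fermionTorusGraph 2 L).Adj X Y then creation (orb X σ) * annihilation (orb Y σ)
        else 0) =
      ∑ x : TorusSite 2 L, ∑ e ∈ unitSteps, ∑ σ : Fin 2,
        creation (orb (FermionTorus.ofTorusSite x) σ) *
          annihilation (orb (FermionTorus.ofTorusSite (x + Torus.proj L e)) σ) := by
  rw [sum_fermionTorus_eq_sum_torusSite]
  refine Finset.sum_congr rfl fun x _ => ?_
  rw [Finset.sum_comm]
  conv_rhs => rw [Finset.sum_comm]
  refine Finset.sum_congr rfl fun σ _ => ?_
  rw [sum_ite_fermionAdj_eq_sum_unitSteps hL]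
  simp only [FermionTorus.toTorusSite_ofTorusSite]

/-- `FermionTorus.ofTorusSite` is injective. [folklore] -/
private theorem ofTorusSite_eq_iff {x y : TorusSite 2 L} :
    FermionTorus.ofTorusSite x = FermionTorus.ofTorusSite y ↔ x = y :=
  (FermionTorus.equivTorusSite (d := 2) (L := L)).symm.injective.eq_iff

end NormalForms

/-! ### The commutator of the Hubbard Hamiltonian with the on-site pair sum -/

section MainCommutator

variable {L : ℕ} [NeZero L]

/-- **You et al. (4) times `N` (one orbital, `μ = 0`)**:
`[H(t,U), Σ_y c_{y↑} c_{y↓}] = t Σ_x Σ_{e ∈ unitSteps} (c_{x↑} c_{x+e,↓} - c_{x↓} c_{x+e,↑}) - U Σ_y c_{y↑} c_{y↓}`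
for `H = hubbardTorus 2 L t U`, `L ≥ 3`: the hopping term contributes `t` times the (unnormalised)
extended-`s` pair sum (`hopping_commutator_pairAnnihilation`, summed with
`hoppingSum_fermionTorus_eq`), the interaction `-U` times the on-site pair sum
(`interaction_commutator_pairAnnihilation`). You–Gu–Tian–Lin (2009), eq. (4); Zhang, PRB 42
(1990) 1012. [cite: YouEtAl2009, eq. (4)] -/
private theorem hubbardTorus_commutator_onsitePairSum (hL : 2 < L) (t U : ℝ) :
    hubbardTorus 2 L t U *
          (∑ y : TorusSite 2 L, annihilation (orb (FermionTorus.ofTorusSite y) 0) *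
            annihilation (orb (FermionTorus.ofTorusSite y) 1)) -
        (∑ y : TorusSite 2 L, annihilation (orb (FermionTorus.ofTorusSite y) 0) *
            annihilation (orb (FermionTorus.ofTorusSite y) 1)) * hubbardTorus 2 L t U =
      (t : ℂ) • (∑ x : TorusSite 2 L, ∑ e ∈ unitSteps,
          (annihilation (orb (FermionTorus.ofTorusSite x) 0) *
              annihilation (orb (FermionTorus.ofTorusSite (x + Torus.proj L e)) 1) -
            annihilation (orb (FermionTorus.ofTorusSite x) 1) *
              annihilation (orb (FermionTorus.ofTorusSite (x + Torus.proj L e)) 0))) -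
        (U : ℂ) • ∑ y : TorusSite 2 L, annihilation (orb (FermionTorus.ofTorusSite y) 0) *
            annihilation (orb (FermionTorus.ofTorusSite y) 1) := by
  -- abbreviations
  set Δ : Matrix (Finset (Orb (FermionTorus 2 L))) (Finset (Orb (FermionTorus 2 L))) ℂ :=
    ∑ y : TorusSite 2 L, annihilation (orb (FermionTorus.ofTorusSite y) 0) *
      annihilation (orb (FermionTorus.ofTorusSite y) 1) with hΔ
  set T : Matrix (Finset (Orb (FermionTorus 2 L))) (Finset (Orb (FermionTorus 2 L))) ℂ :=
    ∑ x : TorusSite 2 L, ∑ e ∈ unitSteps, ∑ σ : Fin 2,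
      creation (orb (FermionTorus.ofTorusSite x) σ) *
        annihilation (orb (FermionTorus.ofTorusSite (x + Torus.proj L e)) σ) with hT
  set D : Matrix (Finset (Orb (FermionTorus 2 L))) (Finset (Orb (FermionTorus 2 L))) ℂ :=
    ∑ X : FermionTorus 2 L, numberOp X 0 * numberOp X 1 with hD
  -- the two commutators
  have hTΔ : T * Δ - Δ * T = ∑ x : TorusSite 2 L, ∑ e ∈ unitSteps,
      (annihilation (orb (FermionTorus.ofTorusSite x) 1) *
          annihilation (orb (FermionTorus.ofTorusSite (x + Torus.proj L e)) 0) -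
        annihilation (orb (FermionTorus.ofTorusSite x) 0) *
          annihilation (orb (FermionTorus.ofTorusSite (x + Torus.proj L e)) 1)) := by
    rw [hT, Finset.sum_mul, Finset.mul_sum, ← Finset.sum_sub_distrib]
    refine Finset.sum_congr rfl fun x _ => ?_
    rw [Finset.sum_mul, Finset.mul_sum, ← Finset.sum_sub_distrib]
    refine Finset.sum_congr rfl fun e _ => ?_
    rw [hΔ, Finset.mul_sum, Finset.sum_mul, ← Finset.sum_sub_distrib]
    simp only [hopping_commutator_pairAnnihilation, ofTorusSite_eq_iff, Finset.sum_ite_eq,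
      Finset.mem_univ, if_true]
  have hDΔ : D * Δ - Δ * D = -Δ := by
    rw [hΔ, Finset.mul_sum, Finset.sum_mul, ← Finset.sum_sub_distrib, ← Finset.sum_neg_distrib]
    refine Finset.sum_congr rfl fun y _ => ?_
    rw [hD]
    exact interaction_commutator_pairAnnihilation (FermionTorus.ofTorusSite y)
  -- the Hamiltonian in unit-step form
  have hH : hubbardTorus 2 L t U = -(t : ℂ) • T + (U : ℂ) • D := by
    unfold hubbardTorus hamiltonian
    rw [hoppingSum_fermionTorus_eq hL]
  rw [hH]
  calc (-(t : ℂ) • T + (U : ℂ) • D) * Δ - Δ * (-(t : ℂ) • T + (U : ℂ) • D)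
      = -(t : ℂ) • (T * Δ - Δ * T) + (U : ℂ) • (D * Δ - Δ * D) := by
        rw [add_mul, mul_add, smul_mul_assoc, smul_mul_assoc, mul_smul_comm, mul_smul_comm,
          smul_sub, smul_sub]
        abel
    _ = _ := by
        rw [hTΔ, hDΔ, smul_neg, ← sub_eq_add_neg, neg_smul, ← smul_neg, ← Finset.sum_neg_distrib]
        congr 2
        refine Finset.sum_congr rfl fun x _ => ?_
        rw [← Finset.sum_neg_distrib]
        exact Finset.sum_congr rfl fun e _ => neg_sub _ _

end MainCommutator

end ZhangPairing

open ZhangPairing in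
/-- **Discharge of `zhang_pairing_commutator` (Zhang's identity).** On the fermionic torus
`(ℤ/Lℤ)²` with `L ≥ 3`, for all real `t`, `U`:
`H P_s - P_s H = 2t P_{s*} - U P_s`, `H = hubbardTorus 2 L t U`, `P_s = pairField sWave L`,
`P_{s*} = pairField extendedSWave L` — the one-orbital, `μ = 0` case of You–Gu–Tian–Lin (2009)
eq. (4), `[H, Δ_s] = t Δ_{s*} - (U - 2μ) Δ_s` (Zhang 1990), multiplied by `√2 N`
(`P_s = √2 N Δ_s`, `P_{s*} = N Δ_{s*}/√2`: `pairField_sWave_eq`, `pairField_extendedSWave_eq`,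
`hubbardTorus_commutator_onsitePairSum`). Source of record Zhang, PRB 42 (1990) 1012
(`ZhangPRB1990`, paywalled); equation read in the open-access restatement.
[cite: YouEtAl2009, eq. (4), one-orbital case = ZhangPRB1990] -/
theorem zhang_pairing_commutator_holds : zhang_pairing_commutator := by
  intro L _ hL t U
  rw [pairField_extendedSWave_eq, pairField_sWave_eq, mul_smul_comm, smul_mul_assoc, ← smul_sub,
    hubbardTorus_commutator_onsitePairSum hL t U]
  simp only [smul_sub, smul_smul, two_mul_mul_inv_sqrt_two, mul_comm (U : ℂ) ((Real.sqrt 2 : ℝ) : ℂ)]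

end Literature.MathematicalPhysics.QuantumLattice

end
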